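import Summits.Ventures.YMGap.RobustBall.TierTwoFrontierSU2
import Summits.Ventures.YMGap.RobustBall.MassiveOnBallZdW
import Summits.Ventures.YMGap.RobustBall.PeriodisedDLRSummable
import HarnessLib

/-!
# Venture YMGap, track ROBUST-BALL (Y2) — tier-2 `SU(2)` FRONTIER CELLS beyond the tables: EVERY DLR STATE IS MASSIVE (`ℤ⁴`) / satisfies the
# Osterwalder–Seiler clause (`ℤ³`), and the van Hove limit IS the one state — `ℤ⁴` (17/50,.007) (7/20,.004) (9/25,.00005), `ℤ³` (13/25,.01)
# (27/50,.004) (11/20,.002) (14/25,.00005); the Wilson points up to the endpoints `9/25` (`ℤ⁴`) and `14/25` (`ℤ³`)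

HONEST FRAMING. WHAT THIS IS: a venture file (cell `pub-ymgap`, track Y2 ROBUST-BALL, seat ds-2): one-line consequences of the frontier window cells
of `TierTwoFrontierSU2.lean` through the massive bridge (`massive_of_starWindowBoundZdW` at `d = 4`, `massiveClause_of_starWindowBoundZdW` at every `d`;
`MassiveOnBallZdW.lean`) and «C-ONE-W» (`oneState_onBallZdW`, `PeriodisedDLRSummable.lean`). For each frontier cell and EVERY member `W` of
`MemBallZdW (1/100) (2ε) ε` (gauge-invariant summable perturbations of `SU(2)` Wilson of ARBITRARY range; tree coupling `β_W/2`): on `ℤ⁴`, DLR states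
exist and EVERY DLR state is an Osterwalder–Seiler MASSIVE STATE with exponentially decaying plaquette–plaquette correlations
(`su2_massive_onBallZdW_star_<cell>`); on `ℤ³`, every DLR state satisfies the Osterwalder–Seiler clause verbatim
(`su2_massiveClause_onBallZdW_dim3_star_<cell>`; `IsMassiveState` is a `d = 4` predicate of the tree); on both, every infinite-volume limit state
of the periodised torus states IS the one DLR state and one exists (`su2_vanHove_oneState_star_<cell>` / `…_dim3_star_<cell>`). Up-to forms on the
endpoint balls and ★ the WILSON POINTS: `su2_wilson_massive_upTo_nineTwentyFifths` (for EVERY `0 ≤ β_W ≤ 9/25`, every DLR state of `SU(2)` Wilson on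
`ℤ⁴`, read through `perturbedYMS … 0`, is MASSIVE) and `su2_wilson_massiveClause_dim3_upTo_fourteenTwentyFifths` (`ℤ³`, every `0 ≤ β_W ≤ 14/25`).
WHAT THIS IS NOT: strong-coupling LATTICE statements; rate and endpoints are door artefacts; nothing about the continuum, a transfer-matrix gap or
the Millennium problem.
-/

noncomputable section

open MeasureTheory ProbabilityTheory Function Finset Real
open scoped NNReal
open Literature.Probability.LatticeModels
open Literature.MathematicalPhysics.QuantumLattice hiding torusNorm
open Literature.MathematicalPhysics.QuantumFieldTheory hiding ZdEdge
open Literature.Barriers.QuantumFields (IsMassiveState)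
open Summit.Ventures.YMGap.DSWindowZd
open Summit.Ventures.YMGap.StarResolventDim (gaugeR doorPoly Delta)

namespace Summit.Ventures.YMGap.RobustBall

/-- **MASSIVE, frontier cell `(17 / 50, 0.007)`**: for every member of `MemBallZdW (1/100) (7 / 500) (7 / 1000)`, DLR states of `(17 / 100)·S_W + W` exist and
EVERY DLR state is massive with exponentially decaying plaquette–plaquette correlations; HYPOTHESIS-FREE. [folklore] -/
theorem su2_massive_onBallZdW_star_seventeenFiftieths :
    ∀ W : Potential (ZdEdge 4) (SUN 2), MemBallZdW (1 / 100) (7 / 500) (7 / 1000) W →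
      (perturbedGibbsMeasuresS (d := 4) (fundamentalRep (Fin 2)) (17 / 100) W).Nonempty ∧
        ∀ μ ∈ perturbedGibbsMeasuresS (d := 4) (fundamentalRep (Fin 2)) (17 / 100) W,
          IsMassiveState μ ∧ HasExponentialDecay (plaquetteCorrFn (fundamentalRep (Fin 2)) μ) := by
  intro W hW
  have e : ((2 : ℕ) : ℝ) * ((17 / 50 : ℝ) / 4) = 17 / 100 := by norm_num
  have h := massive_of_starWindowBoundZdW (N := 2) (by norm_num) hW (t := 1 / 1000000) (by norm_num) (by norm_num)
    (by norm_num) (by norm_num) starReach_nonneg (fun s x hx y => norm_sub_le_starReach s hx y)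
    (su2_starWindowBoundZdW_star_seventeenFiftieths W hW)
  rwa [e] at h

/-- **VAN HOVE = THE ONE STATE, frontier cell `(17 / 50, 0.007)`**: every infinite-volume limit state of the member's periodised torus states equals
every DLR state, and such limit states exist. [folklore] -/
theorem su2_vanHove_oneState_star_seventeenFiftieths :
    ∀ (W : Potential (ZdEdge 4) (SUN 2)) (hW : MemBallZdW (1 / 100) (7 / 500) (7 / 1000) W),
      (∀ μ ∈ perturbedLimitPoints (17 / 100) (periodisedFamilyS W hW.dependsOn hW.gaugeInvariant hW.continuous),
        ∀ ν ∈ perturbedGibbsMeasuresS (d := 4) (fundamentalRep (Fin 2)) (17 / 100) W, μ = ν) ∧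
      ∃ μ ∈ perturbedLimitPoints (17 / 100) (periodisedFamilyS W hW.dependsOn hW.gaugeInvariant hW.continuous),
        μ ∈ perturbedGibbsMeasuresS (d := 4) (fundamentalRep (Fin 2)) (17 / 100) W := by
  intro W hW
  have e : ((2 : ℕ) : ℝ) * (17 / 200 : ℝ) = 17 / 100 := by norm_num
  refine ⟨fun μ hμ ν hν => ?_, exists_limitState_onBallZdW _ hW⟩
  rw [← e] at hμ hν
  exact oneState_onBallZdW su2_massGapOnBallZdW_star_seventeenFiftieths hW hμ hν

/-- **MASSIVE, frontier cell `(7 / 20, 0.004)`**: for every member of `MemBallZdW (1/100) (1 / 125) (1 / 250)`, DLR states of `(7 / 40)·S_W + W` exist and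
EVERY DLR state is massive with exponentially decaying plaquette–plaquette correlations; HYPOTHESIS-FREE. [folklore] -/
theorem su2_massive_onBallZdW_star_sevenTwentieths :
    ∀ W : Potential (ZdEdge 4) (SUN 2), MemBallZdW (1 / 100) (1 / 125) (1 / 250) W →
      (perturbedGibbsMeasuresS (d := 4) (fundamentalRep (Fin 2)) (7 / 40) W).Nonempty ∧
        ∀ μ ∈ perturbedGibbsMeasuresS (d := 4) (fundamentalRep (Fin 2)) (7 / 40) W,
          IsMassiveState μ ∧ HasExponentialDecay (plaquetteCorrFn (fundamentalRep (Fin 2)) μ) := by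
  intro W hW
  have e : ((2 : ℕ) : ℝ) * ((7 / 20 : ℝ) / 4) = 7 / 40 := by norm_num
  have h := massive_of_starWindowBoundZdW (N := 2) (by norm_num) hW (t := 1 / 1000000) (by norm_num) (by norm_num)
    (by norm_num) (by norm_num) starReach_nonneg (fun s x hx y => norm_sub_le_starReach s hx y)
    (su2_starWindowBoundZdW_star_sevenTwentieths W hW)
  rwa [e] at h

/-- **VAN HOVE = THE ONE STATE, frontier cell `(7 / 20, 0.004)`**: every infinite-volume limit state of the member's periodised torus states equals
every DLR state, and such limit states exist. [folklore] -/
theorem su2_vanHove_oneState_star_sevenTwentieths :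
    ∀ (W : Potential (ZdEdge 4) (SUN 2)) (hW : MemBallZdW (1 / 100) (1 / 125) (1 / 250) W),
      (∀ μ ∈ perturbedLimitPoints (7 / 40) (periodisedFamilyS W hW.dependsOn hW.gaugeInvariant hW.continuous),
        ∀ ν ∈ perturbedGibbsMeasuresS (d := 4) (fundamentalRep (Fin 2)) (7 / 40) W, μ = ν) ∧
      ∃ μ ∈ perturbedLimitPoints (7 / 40) (periodisedFamilyS W hW.dependsOn hW.gaugeInvariant hW.continuous),
        μ ∈ perturbedGibbsMeasuresS (d := 4) (fundamentalRep (Fin 2)) (7 / 40) W := by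
  intro W hW
  have e : ((2 : ℕ) : ℝ) * (7 / 80 : ℝ) = 7 / 40 := by norm_num
  refine ⟨fun μ hμ ν hν => ?_, exists_limitState_onBallZdW _ hW⟩
  rw [← e] at hμ hν
  exact oneState_onBallZdW su2_massGapOnBallZdW_star_sevenTwentieths hW hμ hν

/-- **MASSIVE, frontier cell `(9 / 25, 0.00005)`**: for every member of `MemBallZdW (1/100) (1 / 10000) (1 / 20000)`, DLR states of `(9 / 50)·S_W + W` exist and
EVERY DLR state is massive with exponentially decaying plaquette–plaquette correlations; HYPOTHESIS-FREE. [folklore] -/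
theorem su2_massive_onBallZdW_star_nineTwentyFifths :
    ∀ W : Potential (ZdEdge 4) (SUN 2), MemBallZdW (1 / 100) (1 / 10000) (1 / 20000) W →
      (perturbedGibbsMeasuresS (d := 4) (fundamentalRep (Fin 2)) (9 / 50) W).Nonempty ∧
        ∀ μ ∈ perturbedGibbsMeasuresS (d := 4) (fundamentalRep (Fin 2)) (9 / 50) W,
          IsMassiveState μ ∧ HasExponentialDecay (plaquetteCorrFn (fundamentalRep (Fin 2)) μ) := by
  intro W hW
  have e : ((2 : ℕ) : ℝ) * ((9 / 25 : ℝ) / 4) = 9 / 50 := by norm_num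
  have h := massive_of_starWindowBoundZdW (N := 2) (by norm_num) hW (t := 1 / 1000000) (by norm_num) (by norm_num)
    (by norm_num) (by norm_num) starReach_nonneg (fun s x hx y => norm_sub_le_starReach s hx y)
    (su2_starWindowBoundZdW_star_nineTwentyFifths W hW)
  rwa [e] at h

/-- **VAN HOVE = THE ONE STATE, frontier cell `(9 / 25, 0.00005)`**: every infinite-volume limit state of the member's periodised torus states equals
every DLR state, and such limit states exist. [folklore] -/
theorem su2_vanHove_oneState_star_nineTwentyFifths :
    ∀ (W : Potential (ZdEdge 4) (SUN 2)) (hW : MemBallZdW (1 / 100) (1 / 10000) (1 / 20000) W),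
      (∀ μ ∈ perturbedLimitPoints (9 / 50) (periodisedFamilyS W hW.dependsOn hW.gaugeInvariant hW.continuous),
        ∀ ν ∈ perturbedGibbsMeasuresS (d := 4) (fundamentalRep (Fin 2)) (9 / 50) W, μ = ν) ∧
      ∃ μ ∈ perturbedLimitPoints (9 / 50) (periodisedFamilyS W hW.dependsOn hW.gaugeInvariant hW.continuous),
        μ ∈ perturbedGibbsMeasuresS (d := 4) (fundamentalRep (Fin 2)) (9 / 50) W := by
  intro W hW
  have e : ((2 : ℕ) : ℝ) * (9 / 100 : ℝ) = 9 / 50 := by norm_num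
  refine ⟨fun μ hμ ν hν => ?_, exists_limitState_onBallZdW _ hW⟩
  rw [← e] at hμ hν
  exact oneState_onBallZdW su2_massGapOnBallZdW_star_nineTwentyFifths hW hμ hν

/-! ### Up to the endpoint: every DLR state massive, for the whole `9/25` ball and for Wilson -/

/-- **ALL `0 ≤ β_W ≤ 9 / 25` ON THE ENDPOINT BALL, MASSIVE FORM**: for every `β_W ∈ [0, 9/25]` and every member of
`MemBallZdW (1/100) (1 / 10000) (1 / 20000)`, DLR states of `(β_W/2)·S_W + W` exist and every DLR state is massive. [folklore] -/
theorem su2_massive_onBallZdW_star_upTo_nineTwentyFifths {βW : ℝ} (h0 : 0 ≤ βW) (h : βW ≤ 9 / 25) :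
    ∀ W : Potential (ZdEdge 4) (SUN 2), MemBallZdW (1 / 100) (1 / 10000) (1 / 20000) W →
      (perturbedGibbsMeasuresS (d := 4) (fundamentalRep (Fin 2)) (βW / 2) W).Nonempty ∧
        ∀ μ ∈ perturbedGibbsMeasuresS (d := 4) (fundamentalRep (Fin 2)) (βW / 2) W,
          IsMassiveState μ ∧ HasExponentialDecay (plaquetteCorrFn (fundamentalRep (Fin 2)) μ) := by
  intro W hW
  have e : ((2 : ℕ) : ℝ) * (βW / 4) = βW / 2 := by push_cast; ring
  rw [← e]
  refine massive_of_starWindowBoundZdW (N := 2) (by norm_num) hW (t := 1 / 1000000) (ρ := 999 / 1000) (by norm_num)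
    (by norm_num) (by norm_num) (by norm_num) starReach_nonneg (fun s x hx y => norm_sub_le_starReach s hx y) ?_
  refine su2_starWindowBoundZdW_star_gen 20 1000 (by norm_num) (κ := 1 / 100) (t := 1 / 1000000) (τ := 1 / 2500)
    (ε₀ := 1 / 10000) (ε₁ := 1 / 20000) (c := 45011 / 500000) (lam := 71 / 1000000) (S := 1.41422) (ρ' := 999 / 1000)
    (E2b := 1000801 / 1000000) (Gb := 20025 / 10000) (Ab := 10021 / 10000) (Fb := 1 / 22026)
    (F3b := (1000003 / 1000000) * ((1 / 22026) * (10011 / 10000)))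
    (by norm_num) (by norm_num) (by norm_num) h0 (h.trans (by norm_num)) (by norm_num)
    (exp_le_taylor4 (x := 1 / 10000) (by norm_num) (by norm_num)) sqrt_two_le ?_ (by norm_num)
    (by norm_num) (by unfold doorPoly; norm_num) exp_neg_k100_D1000_le (by norm_num)
    exp_tau_w4.1 exp_tau_w4.2 exp_le_A1_k100 exp_far_k100
    (by unfold gaugeR Delta; norm_num) W hW
  calc (1 + 1 / 10000 + (1 / 10000 : ℝ) ^ 2 / 2 + (1 / 10000) ^ 3 / 6 + 5 / 96 * (1 / 10000) ^ 4) *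
        (1 + 2 * 1.41422 * (1 / 20000)) * (βW / 4)
      ≤ (1 + 1 / 10000 + (1 / 10000 : ℝ) ^ 2 / 2 + (1 / 10000) ^ 3 / 6 + 5 / 96 * (1 / 10000) ^ 4) *
        (1 + 2 * 1.41422 * (1 / 20000)) * ((9 / 25) / 4) := by gcongr
    _ ≤ 45011 / 500000 := by norm_num

/-- ★ **THE WILSON POINT UP TO THE STAR DOOR'S ENDPOINT**: for every `0 ≤ β_W ≤ 9/25`, EVERY DLR state of `SU(2)` lattice Yang–Mills on `ℤ⁴`
with Wilson's action at tree coupling `β_W/2` (read through rb-p1's summable specification `perturbedYMS … 0`) is MASSIVE with exponentially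
decaying plaquette–plaquette correlations. [folklore] -/
theorem su2_wilson_massive_upTo_nineTwentyFifths {βW : ℝ} (h0 : 0 ≤ βW) (h : βW ≤ 9 / 25) :
    ∀ μ ∈ perturbedGibbsMeasuresS (d := 4) (fundamentalRep (Fin 2)) (βW / 2) (0 : Potential (ZdEdge 4) (SUN 2)),
      IsMassiveState μ ∧ HasExponentialDecay (plaquetteCorrFn (fundamentalRep (Fin 2)) μ) :=
  (su2_massive_onBallZdW_star_upTo_nineTwentyFifths h0 h 0 (memBallZdW_zero (by norm_num) (by norm_num))).2

/-- **VAN HOVE = THE ONE STATE for every `0 ≤ β_W ≤ 9/25` on the endpoint ball.** [folklore] -/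
theorem su2_vanHove_oneState_star_upTo_nineTwentyFifths {βW : ℝ} (h0 : 0 ≤ βW) (h : βW ≤ 9 / 25) :
    ∀ (W : Potential (ZdEdge 4) (SUN 2)) (hW : MemBallZdW (1 / 100) (1 / 10000) (1 / 20000) W),
      ∀ μ ∈ perturbedLimitPoints (((2 : ℕ) : ℝ) * (βW / 4)) (periodisedFamilyS W hW.dependsOn hW.gaugeInvariant hW.continuous),
        ∀ ν ∈ perturbedGibbsMeasuresS (d := 4) (fundamentalRep (Fin 2)) (((2 : ℕ) : ℝ) * (βW / 4)) W, μ = ν :=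
  fun _ hW _ hμ _ hν => oneState_onBallZdW (su2_massGapOnBallZdW_star_upTo_nineTwentyFifths h0 h) hW hμ hν

/-! ## The `ℤ³` frontier: massive clause and «C-ONE-W» -/


/-- **`ℤ³` MASSIVE CLAUSE, frontier cell `(13 / 25, 0.01)`**: for every member of `MemBallZdW (1/100) (1 / 50) (1 / 100)` and every DLR state of
`(13 / 50)·S_W + W` on `ℤ³`, the truncated correlations of ALL bounded measurable local observables decay exponentially at one rate;
HYPOTHESIS-FREE. [folklore] -/
theorem su2_massiveClause_onBallZdW_dim3_star_thirteenTwentyFifths :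
    ∀ W : Potential (ZdEdge 3) (SUN 2), MemBallZdW (1 / 100) (1 / 50) (1 / 100) W →
      ∀ μ ∈ perturbedGibbsMeasuresS (d := 3) (fundamentalRep (Fin 2)) (13 / 50) W,
        ∃ m : ℝ, ∀ F₁ F₂ : LGConfig 3 (SUN 2) → ℝ,
          Literature.MathematicalPhysics.QuantumLattice.IsLocalObservable F₁ →
          Literature.MathematicalPhysics.QuantumLattice.IsLocalObservable F₂ →
          Measurable F₁ → Measurable F₂ → (∃ C, ∀ U, |F₁ U| ≤ C) → (∃ C, ∀ U, |F₂ U| ≤ C) →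
            HasExponentialDecayRate
              (fun x : Site 3 => cov[F₁, fun U => F₂ (Literature.MathematicalPhysics.QuantumLattice.configShift x U); μ]) m := by
  intro W hW
  have e : ((2 : ℕ) : ℝ) * ((13 / 25 : ℝ) / 4) = 13 / 50 := by norm_num
  have h := massiveClause_of_starWindowBoundZdW (d := 3) (N := 2) (by norm_num) (by norm_num) hW (t := 1 / 1000000)
    (by norm_num) (by norm_num) (by norm_num) (by norm_num) starReach_nonneg (fun s x hx y => norm_sub_le_starReach s hx y)
    (su2_starWindowBoundZdW_dim3_star_thirteenTwentyFifths W hW)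
  rwa [e] at h

/-- **VAN HOVE = THE ONE STATE, `ℤ³` frontier cell `(13 / 25, 0.01)`**: every infinite-volume limit state of the member's periodised torus states
equals every DLR state, and such limit states exist. [folklore] -/
theorem su2_vanHove_oneState_dim3_star_thirteenTwentyFifths :
    ∀ (W : Potential (ZdEdge 3) (SUN 2)) (hW : MemBallZdW (1 / 100) (1 / 50) (1 / 100) W),
      (∀ μ ∈ perturbedLimitPoints (13 / 50) (periodisedFamilyS W hW.dependsOn hW.gaugeInvariant hW.continuous),
        ∀ ν ∈ perturbedGibbsMeasuresS (d := 3) (fundamentalRep (Fin 2)) (13 / 50) W, μ = ν) ∧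
      ∃ μ ∈ perturbedLimitPoints (13 / 50) (periodisedFamilyS W hW.dependsOn hW.gaugeInvariant hW.continuous),
        μ ∈ perturbedGibbsMeasuresS (d := 3) (fundamentalRep (Fin 2)) (13 / 50) W := by
  intro W hW
  have e : ((2 : ℕ) : ℝ) * (13 / 100 : ℝ) = 13 / 50 := by norm_num
  refine ⟨fun μ hμ ν hν => ?_, exists_limitState_onBallZdW _ hW⟩
  rw [← e] at hμ hν
  exact oneState_onBallZdW su2_massGapOnBallZdW_dim3_star_thirteenTwentyFifths hW hμ hν

/-- **`ℤ³` MASSIVE CLAUSE, frontier cell `(27 / 50, 0.004)`**: for every member of `MemBallZdW (1/100) (1 / 125) (1 / 250)` and every DLR state of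
`(27 / 100)·S_W + W` on `ℤ³`, the truncated correlations of ALL bounded measurable local observables decay exponentially at one rate;
HYPOTHESIS-FREE. [folklore] -/
theorem su2_massiveClause_onBallZdW_dim3_star_twentySevenFiftieths :
    ∀ W : Potential (ZdEdge 3) (SUN 2), MemBallZdW (1 / 100) (1 / 125) (1 / 250) W →
      ∀ μ ∈ perturbedGibbsMeasuresS (d := 3) (fundamentalRep (Fin 2)) (27 / 100) W,
        ∃ m : ℝ, ∀ F₁ F₂ : LGConfig 3 (SUN 2) → ℝ,
          Literature.MathematicalPhysics.QuantumLattice.IsLocalObservable F₁ →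
          Literature.MathematicalPhysics.QuantumLattice.IsLocalObservable F₂ →
          Measurable F₁ → Measurable F₂ → (∃ C, ∀ U, |F₁ U| ≤ C) → (∃ C, ∀ U, |F₂ U| ≤ C) →
            HasExponentialDecayRate
              (fun x : Site 3 => cov[F₁, fun U => F₂ (Literature.MathematicalPhysics.QuantumLattice.configShift x U); μ]) m := by
  intro W hW
  have e : ((2 : ℕ) : ℝ) * ((27 / 50 : ℝ) / 4) = 27 / 100 := by norm_num
  have h := massiveClause_of_starWindowBoundZdW (d := 3) (N := 2) (by norm_num) (by norm_num) hW (t := 1 / 1000000)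
    (by norm_num) (by norm_num) (by norm_num) (by norm_num) starReach_nonneg (fun s x hx y => norm_sub_le_starReach s hx y)
    (su2_starWindowBoundZdW_dim3_star_twentySevenFiftieths W hW)
  rwa [e] at h

/-- **VAN HOVE = THE ONE STATE, `ℤ³` frontier cell `(27 / 50, 0.004)`**: every infinite-volume limit state of the member's periodised torus states
equals every DLR state, and such limit states exist. [folklore] -/
theorem su2_vanHove_oneState_dim3_star_twentySevenFiftieths :
    ∀ (W : Potential (ZdEdge 3) (SUN 2)) (hW : MemBallZdW (1 / 100) (1 / 125) (1 / 250) W),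
      (∀ μ ∈ perturbedLimitPoints (27 / 100) (periodisedFamilyS W hW.dependsOn hW.gaugeInvariant hW.continuous),
        ∀ ν ∈ perturbedGibbsMeasuresS (d := 3) (fundamentalRep (Fin 2)) (27 / 100) W, μ = ν) ∧
      ∃ μ ∈ perturbedLimitPoints (27 / 100) (periodisedFamilyS W hW.dependsOn hW.gaugeInvariant hW.continuous),
        μ ∈ perturbedGibbsMeasuresS (d := 3) (fundamentalRep (Fin 2)) (27 / 100) W := by
  intro W hW
  have e : ((2 : ℕ) : ℝ) * (27 / 200 : ℝ) = 27 / 100 := by norm_num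
  refine ⟨fun μ hμ ν hν => ?_, exists_limitState_onBallZdW _ hW⟩
  rw [← e] at hμ hν
  exact oneState_onBallZdW su2_massGapOnBallZdW_dim3_star_twentySevenFiftieths hW hμ hν

/-- **`ℤ³` MASSIVE CLAUSE, frontier cell `(11 / 20, 0.002)`**: for every member of `MemBallZdW (1/100) (1 / 250) (1 / 500)` and every DLR state of
`(11 / 40)·S_W + W` on `ℤ³`, the truncated correlations of ALL bounded measurable local observables decay exponentially at one rate;
HYPOTHESIS-FREE. [folklore] -/
theorem su2_massiveClause_onBallZdW_dim3_star_elevenTwentieths :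
    ∀ W : Potential (ZdEdge 3) (SUN 2), MemBallZdW (1 / 100) (1 / 250) (1 / 500) W →
      ∀ μ ∈ perturbedGibbsMeasuresS (d := 3) (fundamentalRep (Fin 2)) (11 / 40) W,
        ∃ m : ℝ, ∀ F₁ F₂ : LGConfig 3 (SUN 2) → ℝ,
          Literature.MathematicalPhysics.QuantumLattice.IsLocalObservable F₁ →
          Literature.MathematicalPhysics.QuantumLattice.IsLocalObservable F₂ →
          Measurable F₁ → Measurable F₂ → (∃ C, ∀ U, |F₁ U| ≤ C) → (∃ C, ∀ U, |F₂ U| ≤ C) →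
            HasExponentialDecayRate
              (fun x : Site 3 => cov[F₁, fun U => F₂ (Literature.MathematicalPhysics.QuantumLattice.configShift x U); μ]) m := by
  intro W hW
  have e : ((2 : ℕ) : ℝ) * ((11 / 20 : ℝ) / 4) = 11 / 40 := by norm_num
  have h := massiveClause_of_starWindowBoundZdW (d := 3) (N := 2) (by norm_num) (by norm_num) hW (t := 1 / 1000000)
    (by norm_num) (by norm_num) (by norm_num) (by norm_num) starReach_nonneg (fun s x hx y => norm_sub_le_starReach s hx y)
    (su2_starWindowBoundZdW_dim3_star_elevenTwentieths W hW)
  rwa [e] at h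

/-- **VAN HOVE = THE ONE STATE, `ℤ³` frontier cell `(11 / 20, 0.002)`**: every infinite-volume limit state of the member's periodised torus states
equals every DLR state, and such limit states exist. [folklore] -/
theorem su2_vanHove_oneState_dim3_star_elevenTwentieths :
    ∀ (W : Potential (ZdEdge 3) (SUN 2)) (hW : MemBallZdW (1 / 100) (1 / 250) (1 / 500) W),
      (∀ μ ∈ perturbedLimitPoints (11 / 40) (periodisedFamilyS W hW.dependsOn hW.gaugeInvariant hW.continuous),
        ∀ ν ∈ perturbedGibbsMeasuresS (d := 3) (fundamentalRep (Fin 2)) (11 / 40) W, μ = ν) ∧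
      ∃ μ ∈ perturbedLimitPoints (11 / 40) (periodisedFamilyS W hW.dependsOn hW.gaugeInvariant hW.continuous),
        μ ∈ perturbedGibbsMeasuresS (d := 3) (fundamentalRep (Fin 2)) (11 / 40) W := by
  intro W hW
  have e : ((2 : ℕ) : ℝ) * (11 / 80 : ℝ) = 11 / 40 := by norm_num
  refine ⟨fun μ hμ ν hν => ?_, exists_limitState_onBallZdW _ hW⟩
  rw [← e] at hμ hν
  exact oneState_onBallZdW su2_massGapOnBallZdW_dim3_star_elevenTwentieths hW hμ hν

/-- **`ℤ³` MASSIVE CLAUSE, frontier cell `(14 / 25, 0.00005)`**: for every member of `MemBallZdW (1/100) (1 / 10000) (1 / 20000)` and every DLR state of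
`(7 / 25)·S_W + W` on `ℤ³`, the truncated correlations of ALL bounded measurable local observables decay exponentially at one rate;
HYPOTHESIS-FREE. [folklore] -/
theorem su2_massiveClause_onBallZdW_dim3_star_fourteenTwentyFifths :
    ∀ W : Potential (ZdEdge 3) (SUN 2), MemBallZdW (1 / 100) (1 / 10000) (1 / 20000) W →
      ∀ μ ∈ perturbedGibbsMeasuresS (d := 3) (fundamentalRep (Fin 2)) (7 / 25) W,
        ∃ m : ℝ, ∀ F₁ F₂ : LGConfig 3 (SUN 2) → ℝ,
          Literature.MathematicalPhysics.QuantumLattice.IsLocalObservable F₁ →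
          Literature.MathematicalPhysics.QuantumLattice.IsLocalObservable F₂ →
          Measurable F₁ → Measurable F₂ → (∃ C, ∀ U, |F₁ U| ≤ C) → (∃ C, ∀ U, |F₂ U| ≤ C) →
            HasExponentialDecayRate
              (fun x : Site 3 => cov[F₁, fun U => F₂ (Literature.MathematicalPhysics.QuantumLattice.configShift x U); μ]) m := by
  intro W hW
  have e : ((2 : ℕ) : ℝ) * ((14 / 25 : ℝ) / 4) = 7 / 25 := by norm_num
  have h := massiveClause_of_starWindowBoundZdW (d := 3) (N := 2) (by norm_num) (by norm_num) hW (t := 1 / 1000000)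
    (by norm_num) (by norm_num) (by norm_num) (by norm_num) starReach_nonneg (fun s x hx y => norm_sub_le_starReach s hx y)
    (su2_starWindowBoundZdW_dim3_star_fourteenTwentyFifths W hW)
  rwa [e] at h

/-- **VAN HOVE = THE ONE STATE, `ℤ³` frontier cell `(14 / 25, 0.00005)`**: every infinite-volume limit state of the member's periodised torus states
equals every DLR state, and such limit states exist. [folklore] -/
theorem su2_vanHove_oneState_dim3_star_fourteenTwentyFifths :
    ∀ (W : Potential (ZdEdge 3) (SUN 2)) (hW : MemBallZdW (1 / 100) (1 / 10000) (1 / 20000) W),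
      (∀ μ ∈ perturbedLimitPoints (7 / 25) (periodisedFamilyS W hW.dependsOn hW.gaugeInvariant hW.continuous),
        ∀ ν ∈ perturbedGibbsMeasuresS (d := 3) (fundamentalRep (Fin 2)) (7 / 25) W, μ = ν) ∧
      ∃ μ ∈ perturbedLimitPoints (7 / 25) (periodisedFamilyS W hW.dependsOn hW.gaugeInvariant hW.continuous),
        μ ∈ perturbedGibbsMeasuresS (d := 3) (fundamentalRep (Fin 2)) (7 / 25) W := by
  intro W hW
  have e : ((2 : ℕ) : ℝ) * (7 / 50 : ℝ) = 7 / 25 := by norm_num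
  refine ⟨fun μ hμ ν hν => ?_, exists_limitState_onBallZdW _ hW⟩
  rw [← e] at hμ hν
  exact oneState_onBallZdW su2_massGapOnBallZdW_dim3_star_fourteenTwentyFifths hW hμ hν

/-! ### Up to the `ℤ³` endpoint: the massive clause for the whole `14/25` ball and for Wilson -/

/-- **ALL `0 ≤ β_W ≤ 14 / 25` ON THE `ℤ³` ENDPOINT BALL, MASSIVE CLAUSE**: for every `β_W ∈ [0, 14/25]`, every member of
`MemBallZdW (1/100) (1 / 10000) (1 / 20000)` and every DLR state of `(β_W/2)·S_W + W` on `ℤ³`, the Osterwalder–Seiler clause holds. [folklore] -/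
theorem su2_massiveClause_onBallZdW_dim3_star_upTo_fourteenTwentyFifths {βW : ℝ} (h0 : 0 ≤ βW) (h : βW ≤ 14 / 25) :
    ∀ W : Potential (ZdEdge 3) (SUN 2), MemBallZdW (1 / 100) (1 / 10000) (1 / 20000) W →
      ∀ μ ∈ perturbedGibbsMeasuresS (d := 3) (fundamentalRep (Fin 2)) (βW / 2) W,
        ∃ m : ℝ, ∀ F₁ F₂ : LGConfig 3 (SUN 2) → ℝ,
          Literature.MathematicalPhysics.QuantumLattice.IsLocalObservable F₁ →
          Literature.MathematicalPhysics.QuantumLattice.IsLocalObservable F₂ →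
          Measurable F₁ → Measurable F₂ → (∃ C, ∀ U, |F₁ U| ≤ C) → (∃ C, ∀ U, |F₂ U| ≤ C) →
            HasExponentialDecayRate
              (fun x : Site 3 => cov[F₁, fun U => F₂ (Literature.MathematicalPhysics.QuantumLattice.configShift x U); μ]) m := by
  intro W hW
  have e : ((2 : ℕ) : ℝ) * (βW / 4) = βW / 2 := by push_cast; ring
  rw [← e]
  refine massiveClause_of_starWindowBoundZdW (d := 3) (N := 2) (by norm_num) (by norm_num) hW (t := 1 / 1000000) (ρ := 999 / 1000)
    (by norm_num) (by norm_num) (by norm_num) (by norm_num) starReach_nonneg (fun s x hx y => norm_sub_le_starReach s hx y) ?_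
  refine su2_starWindowBoundZdW_dim3_star_gen 20 1000 (by norm_num) (κ := 1 / 100) (t := 1 / 1000000) (τ := 1 / 2500)
    (ε₀ := 1 / 10000) (ε₁ := 1 / 20000) (c := 70017 / 500000) (lam := 71 / 1000000) (S := 1.41422) (ρ' := 999 / 1000)
    (E2b := 1000801 / 1000000) (Gb := 20025 / 10000) (Ab := 10021 / 10000) (Fb := 1 / 22026)
    (F3b := (1000003 / 1000000) * ((1 / 22026) * (10011 / 10000)))
    (by norm_num) (by norm_num) (by norm_num) h0 (h.trans (by norm_num)) (by norm_num)
    (exp_le_taylor4 (x := 1 / 10000) (by norm_num) (by norm_num)) sqrt_two_le ?_ (by norm_num)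
    (by norm_num) (by unfold doorPoly; norm_num) exp_neg_k100_D1000_le (by norm_num)
    exp_tau_w4.1 exp_tau_w4.2 exp_le_A1_k100 exp_far_k100
    (by unfold gaugeR Delta; norm_num) W hW
  calc (1 + 1 / 10000 + (1 / 10000 : ℝ) ^ 2 / 2 + (1 / 10000) ^ 3 / 6 + 5 / 96 * (1 / 10000) ^ 4) *
        (1 + 2 * 1.41422 * (1 / 20000)) * (βW / 4)
      ≤ (1 + 1 / 10000 + (1 / 10000 : ℝ) ^ 2 / 2 + (1 / 10000) ^ 3 / 6 + 5 / 96 * (1 / 10000) ^ 4) *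
        (1 + 2 * 1.41422 * (1 / 20000)) * ((14 / 25) / 4) := by gcongr
    _ ≤ 70017 / 500000 := by norm_num

/-- ★ **THE WILSON POINT ON `ℤ³` UP TO THE STAR DOOR'S ENDPOINT**: for every `0 ≤ β_W ≤ 14/25` and EVERY DLR state of `SU(2)` lattice
Yang–Mills on `ℤ³` with Wilson's action at tree coupling `β_W/2` (read through `perturbedYMS … 0`), the truncated correlations of ALL bounded
measurable local observables decay exponentially at one rate. [folklore] -/
theorem su2_wilson_massiveClause_dim3_upTo_fourteenTwentyFifths {βW : ℝ} (h0 : 0 ≤ βW) (h : βW ≤ 14 / 25) :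
    ∀ μ ∈ perturbedGibbsMeasuresS (d := 3) (fundamentalRep (Fin 2)) (βW / 2) (0 : Potential (ZdEdge 3) (SUN 2)),
      ∃ m : ℝ, ∀ F₁ F₂ : LGConfig 3 (SUN 2) → ℝ,
          Literature.MathematicalPhysics.QuantumLattice.IsLocalObservable F₁ →
          Literature.MathematicalPhysics.QuantumLattice.IsLocalObservable F₂ →
          Measurable F₁ → Measurable F₂ → (∃ C, ∀ U, |F₁ U| ≤ C) → (∃ C, ∀ U, |F₂ U| ≤ C) →
            HasExponentialDecayRate
              (fun x : Site 3 => cov[F₁, fun U => F₂ (Literature.MathematicalPhysics.QuantumLattice.configShift x U); μ]) m :=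
  su2_massiveClause_onBallZdW_dim3_star_upTo_fourteenTwentyFifths h0 h 0 (memBallZdW_zero (by norm_num) (by norm_num))

/-! ## Headline packages up to the endpoints -/

/-- ★★ **HEADLINE, `SU(2)`, `ℤ⁴`, TIER 2, UP TO THE STAR DOOR'S ENDPOINT `β_W = 9/25`**: for every `0 ≤ β_W ≤ 9/25` and EVERY member `W` of
`MemBallZdW (1/100) (1/10000) (1/20000)` (gauge-invariant summable perturbations of `SU(2)` Wilson on `ℤ⁴` of arbitrary range; `W = 0` is Wilson):
(i) `PerturbedMassGapAtS 4 2 (β_W/4) W` — exactly one DLR state + Shen–Zhu–Zhu clustering; (ii) DLR states exist and EVERY DLR state is MASSIVE with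
plaquette–plaquette decay; (iii) every van Hove limit state of the periodised torus states IS that DLR state. [folklore] -/
theorem su2_tierTwo_upTo_nineTwentyFifths {βW : ℝ} (h0 : 0 ≤ βW) (h : βW ≤ 9 / 25)
    (W : Potential (ZdEdge 4) (SUN 2)) (hW : MemBallZdW (1 / 100) (1 / 10000) (1 / 20000) W) :
    PerturbedMassGapAtS 4 2 (βW / 4) W ∧
    ((perturbedGibbsMeasuresS (d := 4) (fundamentalRep (Fin 2)) (βW / 2) W).Nonempty ∧
      ∀ μ ∈ perturbedGibbsMeasuresS (d := 4) (fundamentalRep (Fin 2)) (βW / 2) W,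
        IsMassiveState μ ∧ HasExponentialDecay (plaquetteCorrFn (fundamentalRep (Fin 2)) μ)) ∧
    ∀ μ ∈ perturbedLimitPoints (βW / 2) (periodisedFamilyS W hW.dependsOn hW.gaugeInvariant hW.continuous),
      ∀ ν ∈ perturbedGibbsMeasuresS (d := 4) (fundamentalRep (Fin 2)) (βW / 2) W, μ = ν := by
  have e : ((2 : ℕ) : ℝ) * (βW / 4) = βW / 2 := by push_cast; ring
  refine ⟨su2_massGapOnBallZdW_star_upTo_nineTwentyFifths h0 h W hW, su2_massive_onBallZdW_star_upTo_nineTwentyFifths h0 h W hW, ?_⟩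
  intro μ hμ ν hν
  rw [← e] at hμ hν
  exact su2_vanHove_oneState_star_upTo_nineTwentyFifths h0 h W hW μ hμ ν hν

/-- ★★ **HEADLINE, `SU(2)`, `ℤ³`, TIER 2, UP TO THE `d = 3` STAR DOOR'S ENDPOINT `β_W = 14/25`**: for every `0 ≤ β_W ≤ 14/25` and EVERY member `W`
of `MemBallZdW (1/100) (1/10000) (1/20000)` on `ℤ³`: (i) `PerturbedMassGapAtS 3 2 (β_W/4) W`; (ii) every DLR state satisfies the Osterwalder–Seiler
clause; (iii) every van Hove limit state of the periodised torus states IS the one DLR state. [folklore] -/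
theorem su2_tierTwo_dim3_upTo_fourteenTwentyFifths {βW : ℝ} (h0 : 0 ≤ βW) (h : βW ≤ 14 / 25)
    (W : Potential (ZdEdge 3) (SUN 2)) (hW : MemBallZdW (1 / 100) (1 / 10000) (1 / 20000) W) :
    PerturbedMassGapAtS 3 2 (βW / 4) W ∧
    (∀ μ ∈ perturbedGibbsMeasuresS (d := 3) (fundamentalRep (Fin 2)) (βW / 2) W,
      ∃ m : ℝ, ∀ F₁ F₂ : LGConfig 3 (SUN 2) → ℝ,
        Literature.MathematicalPhysics.QuantumLattice.IsLocalObservable F₁ →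
        Literature.MathematicalPhysics.QuantumLattice.IsLocalObservable F₂ →
        Measurable F₁ → Measurable F₂ → (∃ C, ∀ U, |F₁ U| ≤ C) → (∃ C, ∀ U, |F₂ U| ≤ C) →
          HasExponentialDecayRate
            (fun x : Site 3 => cov[F₁, fun U => F₂ (Literature.MathematicalPhysics.QuantumLattice.configShift x U); μ]) m) ∧
    ∀ μ ∈ perturbedLimitPoints (βW / 2) (periodisedFamilyS W hW.dependsOn hW.gaugeInvariant hW.continuous),
      ∀ ν ∈ perturbedGibbsMeasuresS (d := 3) (fundamentalRep (Fin 2)) (βW / 2) W, μ = ν := by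
  have e : ((2 : ℕ) : ℝ) * (βW / 4) = βW / 2 := by push_cast; ring
  refine ⟨su2_massGapOnBallZdW_dim3_star_upTo_fourteenTwentyFifths h0 h W hW,
    su2_massiveClause_onBallZdW_dim3_star_upTo_fourteenTwentyFifths h0 h W hW, ?_⟩
  intro μ hμ ν hν
  rw [← e] at hμ hν
  exact oneState_onBallZdW (su2_massGapOnBallZdW_dim3_star_upTo_fourteenTwentyFifths h0 h) hW hμ hν

end Summit.Ventures.YMGap.RobustBall

end
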